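import Summits.QuantumFields.BalabanUV.T4Continuum.Support.NE7SingleGenerator
import HarnessLib

/-!
# NE7CommutingUnitariesResolution — A COMMUTING FAMILY OF UNITARY MATRICES IS DIAGONALISED BY THE SPECTRAL PROJECTIONS OF ONE REAL COMBINATION OF ITS REAL AND IMAGINARY
# PARTS: `c_i E_k = ĉ_i(k) E_k`, `|ĉ_i(k)| = 1`, `c_i⋆ E_k = conj ĉ_i(k) E_k`, `c_i = Σ_k ĉ_i(k) E_k`, and trivial 4-letter words of the family have trivial symbols
# (file S3b-2c of the `k`-uniform stabiliser lifting programme: the exact half of (ACU))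

Cell `pub-balaban`, rung (B)+1 sub-cell t4, lineage `b2b-balaban-t4-ne7b-p1` (row NE7b OWNER + CRUX PROVER; junction service for row NE7, ruling R-OWNER-149-1 (2)),
generation 159.  Memo `t4/b2b-balaban-t4-ne7b-p1/g159/records/S3-BRIEF.md` §2 (b).  Over ✓ `NE7SingleGenerator.exists_separating_combination` and ✓ `NE7SpectralResolution`.
WHAT ([folklore]; 0 def, 0 sorry).  `commute_star_of_unitary` (a unitary commuting with `z` has its adjoint commuting with `z`); **`commuting_unitaries_resolution`**: for commuting
unitaries `c_i` (`i` in a finite type) there are real coefficients `t_i, t′_i` such that `H = Σ_i (t_i Re c_i + t′_i Im c_i)` (`Re c = (c + c⋆)∕2`, `Im c = −(i∕2)(c − c⋆)`) is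
self-adjoint and, with `E_k = cfc 𝟙_{{k}} H` and symbols `ĉ_i(k) ∈ ℂ`: `c_i E_k = ĉ_i(k) E_k` for all `k`; for `k ∈ σ(H)`: `‖ĉ_i(k)‖ = 1`, `c_i⋆ E_k = conj ĉ_i(k) E_k`, and
`c_{i₁} c_{i₂} c_{i₃}⋆ c_{i₄}⋆ = 1 ⇒ ĉ_{i₁} ĉ_{i₂} conj ĉ_{i₃} conj ĉ_{i₄} = 1` at `k`; and `c_i = Σ_{k ∈ σ(H)} ĉ_i(k) E_k`.
HONEST FRAMING (page 1): elementary finite-dimensional spectral theory; nothing of Bałaban's; NOT (ACU), NOT NE7, NOT NE3; row NE7b NOT PRINTED ∕ NOT PROVED; spine 0∕9; finite T⁴ rung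
(B)+1 — NOT infinite volume, NOT mass gap, NOT BetaPertH, NOT Clay.
-/

set_option autoImplicit false

open scoped Matrix.Norms.L2Operator BigOperators ComplexConjugate
open Finset

namespace Summit.QuantumFields.BalabanUV.T4Continuum.NE7CommutingUnitariesResolution

open NE7SpectralResolution (specProj_mul_specProj sum_specProj specProj_ne_zero commute_specProj)
open NE7SingleGenerator (exists_separating_combination)

noncomputable section

variable {n : Type} [Fintype n] [DecidableEq n]

/-- A unitary commuting with `z` has its adjoint commuting with `z`. [folklore] -/
theorem commute_star_of_unitary {u z : Matrix n n ℂ} (hu : u ∈ unitary (Matrix n n ℂ)) (h : z * u = u * z) : z * star u = star u * z := by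
  have h1 : star u * (z * u) * star u = star u * (u * z) * star u := by rw [h]
  have hsu : star u * u = 1 := Unitary.star_mul_self_of_mem hu
  have hus : u * star u = 1 := Unitary.mul_star_self_of_mem hu
  calc z * star u = (star u * u) * z * star u := by rw [hsu, one_mul]
    _ = star u * (u * z) * star u := by noncomm_ring
    _ = star u * (z * u) * star u := by rw [h]
    _ = star u * z * (u * star u) := by noncomm_ring
    _ = star u * z := by rw [hus, mul_one]

omit [Fintype n] [DecidableEq n] in
/-- Real and imaginary parts: `c = Re c + i·Im c` with `Re c = (c + c⋆)/2`, `Im c = −(i/2)(c − c⋆)`. [folklore] -/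
theorem re_add_im (c : Matrix n n ℂ) :
    ((1 / 2 : ℂ)) • (c + star c) + Complex.I • ((-Complex.I / 2) • (c - star c)) = c := by
  rw [smul_smul]
  have h : Complex.I * (-Complex.I / 2) = 1 / 2 := by
    rw [mul_div_assoc', mul_neg, Complex.I_mul_I, neg_neg]
  rw [h, ← smul_add]
  rw [show c + star c + (c - star c) = (2 : ℂ) • c by rw [two_smul]; abel, smul_smul]
  norm_num

omit [Fintype n] [DecidableEq n] in
/-- `Re c = (c + c⋆)/2` is self-adjoint. [folklore] -/
theorem isSelfAdjoint_re (c : Matrix n n ℂ) : IsSelfAdjoint (((1 / 2 : ℂ)) • (c + star c)) := by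
  rw [IsSelfAdjoint, star_smul, star_add, star_star, add_comm]
  congr 1
  rw [Complex.star_def, map_div₀, map_one, map_ofNat]

omit [Fintype n] [DecidableEq n] in
/-- `Im c = −(i/2)(c − c⋆)` is self-adjoint. [folklore] -/
theorem isSelfAdjoint_im (c : Matrix n n ℂ) : IsSelfAdjoint ((-Complex.I / 2) • (c - star c)) := by
  rw [IsSelfAdjoint, star_smul, star_sub, star_star]
  rw [Complex.star_def, map_div₀, map_neg, Complex.conj_I, map_ofNat, neg_neg]
  rw [show star c - c = -(c - star c) by abel, smul_neg, ← neg_smul, neg_div]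

/-- **THE JOINT DIAGONALISATION OF A COMMUTING UNITARY FAMILY BY ONE SELF-ADJOINT COMBINATION** (statement in the module docstring). [folklore] -/
theorem commuting_unitaries_resolution [Nonempty n] {ι : Type} [Fintype ι] [DecidableEq ι] (c : ι → Matrix n n ℂ)
    (hcu : ∀ i, c i ∈ unitary (Matrix n n ℂ)) (hcomm : ∀ i j, c i * c j = c j * c i) :
    ∃ (t t' : ι → ℝ) (ĉ : ι → ℝ → ℂ),
      IsSelfAdjoint (∑ i, (((t i : ℝ) : ℂ) • (((1 / 2 : ℂ)) • (c i + star (c i))) + ((t' i : ℝ) : ℂ) • ((-Complex.I / 2) • (c i - star (c i))))) ∧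
      (∀ (i : ι) (k : ℝ), c i * cfc (fun u : ℝ => if u = k then (1 : ℝ) else 0)
          (∑ i, (((t i : ℝ) : ℂ) • (((1 / 2 : ℂ)) • (c i + star (c i))) + ((t' i : ℝ) : ℂ) • ((-Complex.I / 2) • (c i - star (c i)))))
        = ĉ i k • cfc (fun u : ℝ => if u = k then (1 : ℝ) else 0)
          (∑ i, (((t i : ℝ) : ℂ) • (((1 / 2 : ℂ)) • (c i + star (c i))) + ((t' i : ℝ) : ℂ) • ((-Complex.I / 2) • (c i - star (c i)))))) ∧
      (∀ (i : ι), ∀ k ∈ spectrum ℝ (∑ i, (((t i : ℝ) : ℂ) • (((1 / 2 : ℂ)) • (c i + star (c i))) + ((t' i : ℝ) : ℂ) • ((-Complex.I / 2) • (c i - star (c i))))),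
        ‖ĉ i k‖ = 1 ∧
        star (c i) * cfc (fun u : ℝ => if u = k then (1 : ℝ) else 0)
            (∑ i, (((t i : ℝ) : ℂ) • (((1 / 2 : ℂ)) • (c i + star (c i))) + ((t' i : ℝ) : ℂ) • ((-Complex.I / 2) • (c i - star (c i)))))
          = conj (ĉ i k) • cfc (fun u : ℝ => if u = k then (1 : ℝ) else 0)
            (∑ i, (((t i : ℝ) : ℂ) • (((1 / 2 : ℂ)) • (c i + star (c i))) + ((t' i : ℝ) : ℂ) • ((-Complex.I / 2) • (c i - star (c i)))))) ∧
      (∀ i₁ i₂ i₃ i₄ : ι, c i₁ * c i₂ * star (c i₃) * star (c i₄) = 1 →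
        ∀ k ∈ spectrum ℝ (∑ i, (((t i : ℝ) : ℂ) • (((1 / 2 : ℂ)) • (c i + star (c i))) + ((t' i : ℝ) : ℂ) • ((-Complex.I / 2) • (c i - star (c i))))),
          ĉ i₁ k * ĉ i₂ k * conj (ĉ i₃ k) * conj (ĉ i₄ k) = 1) ∧
      (∀ i : ι, c i = ∑ k ∈ (Matrix.finite_real_spectrum
          (A := ∑ i, (((t i : ℝ) : ℂ) • (((1 / 2 : ℂ)) • (c i + star (c i))) + ((t' i : ℝ) : ℂ) • ((-Complex.I / 2) • (c i - star (c i)))))).toFinset,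
        ĉ i k • cfc (fun u : ℝ => if u = k then (1 : ℝ) else 0)
          (∑ i, (((t i : ℝ) : ℂ) • (((1 / 2 : ℂ)) • (c i + star (c i))) + ((t' i : ℝ) : ℂ) • ((-Complex.I / 2) • (c i - star (c i)))))) := by
  classical
  -- the commuting self-adjoint family of real and imaginary parts, indexed by `Fin m` through `ι ⊕ ι`
  set X : ι → Matrix n n ℂ := fun i => ((1 / 2 : ℂ)) • (c i + star (c i)) with hX
  set Y : ι → Matrix n n ℂ := fun i => (-Complex.I / 2) • (c i - star (c i)) with hY
  have h1 : ∀ i j, Commute (c i) (c j) := fun i j => hcomm i j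
  have h2 : ∀ i j, Commute (c i) (star (c j)) := fun i j => commute_star_of_unitary (hcu j) (hcomm i j)
  have h3 : ∀ i j, Commute (star (c i)) (c j) := fun i j => (h2 j i).symm
  have h4 : ∀ i j, Commute (star (c i)) (star (c j)) := fun i j => by
    have h := congrArg star (hcomm j i); simp only [star_mul] at h; exact h
  have hXX : ∀ i j, Commute (X i) (X j) := fun i j => (((h1 i j).add_right (h2 i j)).add_left ((h3 i j).add_right (h4 i j))).smul_left _ |>.smul_right _
  have hXYc : ∀ i j, Commute (X i) (Y j) := fun i j => (((h1 i j).sub_right (h2 i j)).add_left ((h3 i j).sub_right (h4 i j))).smul_left _ |>.smul_right _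
  have hYX : ∀ i j, Commute (Y i) (X j) := fun i j => (((h1 i j).add_right (h2 i j)).sub_left ((h3 i j).add_right (h4 i j))).smul_left _ |>.smul_right _
  have hYY : ∀ i j, Commute (Y i) (Y j) := fun i j => (((h1 i j).sub_right (h2 i j)).sub_left ((h3 i j).sub_right (h4 i j))).smul_left _ |>.smul_right _
  set e := Fintype.equivFin (ι ⊕ ι) with he
  set xs : Fin (Fintype.card (ι ⊕ ι)) → Matrix n n ℂ := fun s => Sum.elim X Y (e.symm s) with hxs
  have hxs_sa : ∀ s, IsSelfAdjoint (xs s) := by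
    intro s; simp only [hxs]
    cases e.symm s with
    | inl i => exact isSelfAdjoint_re (c i)
    | inr i => exact isSelfAdjoint_im (c i)
  have hxs_comm : ∀ s s', Commute (xs s) (xs s') := by
    intro s s'; simp only [hxs]
    cases e.symm s with
    | inl i =>
        cases e.symm s' with
        | inl j => exact hXX i j
        | inr j => exact hXYc i j
    | inr i =>
        cases e.symm s' with
        | inl j => exact hYX i j
        | inr j => exact hYY i j
  obtain ⟨t₀, ht₀⟩ := exists_separating_combination _ xs hxs_sa hxs_comm
  -- the combination in the `ι`-indexing
  set H : Matrix n n ℂ := ∑ i, (((t₀ (e (Sum.inl i)) : ℝ) : ℂ) • X i + ((t₀ (e (Sum.inr i)) : ℝ) : ℂ) • Y i) with hH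
  have hH₀ : ∑ s, ((t₀ s : ℝ) : ℂ) • xs s = H := by
    rw [hH, ← Equiv.sum_comp e (fun s => ((t₀ s : ℝ) : ℂ) • xs s), Fintype.sum_sum_type, ← Finset.sum_add_distrib]
    refine Finset.sum_congr rfl fun i _ => ?_
    simp only [hxs, Equiv.symm_apply_apply, Sum.elim_inl, Sum.elim_inr]
  -- the symbols
  choose cf hcf using ht₀
  set E : ℝ → Matrix n n ℂ := fun k => cfc (fun u : ℝ => if u = k then (1 : ℝ) else 0) H with hE
  have hXE : ∀ i k, X i * E k = cf (e (Sum.inl i)) k • E k := by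
    intro i k
    have h := hcf (e (Sum.inl i)) k
    rw [hH₀] at h
    simpa only [hxs, Equiv.symm_apply_apply, Sum.elim_inl] using h
  have hYE : ∀ i k, Y i * E k = cf (e (Sum.inr i)) k • E k := by
    intro i k
    have h := hcf (e (Sum.inr i)) k
    rw [hH₀] at h
    simpa only [hxs, Equiv.symm_apply_apply, Sum.elim_inr] using h
  set ĉ : ι → ℝ → ℂ := fun i k => cf (e (Sum.inl i)) k + Complex.I * cf (e (Sum.inr i)) k with hĉ
  have hcE : ∀ i k, c i * E k = ĉ i k • E k := by
    intro i k
    have hci : c i = X i + Complex.I • Y i := (re_add_im (c i)).symm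
    rw [hci, add_mul, hXE, smul_mul_assoc, hYE, smul_smul, ← add_smul]
  have hr : ∀ r : ℝ, IsSelfAdjoint ((r : ℂ)) := fun r => by rw [IsSelfAdjoint, Complex.star_def, Complex.conj_ofReal]
  have hHsa : IsSelfAdjoint H := by
    rw [hH]
    exact Finset.sum_induction _ (fun x => IsSelfAdjoint x) (fun a b ha hb => ha.add hb) (by simp)
      (fun i _ => ((hr _).smul (isSelfAdjoint_re (c i))).add ((hr _).smul (isSelfAdjoint_im (c i))))
  -- on the spectrum: `E_k ≠ 0`, `|ĉ| = 1`, adjoints, words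
  have hEne : ∀ k ∈ spectrum ℝ H, E k ≠ 0 := fun k hk => specProj_ne_zero H hHsa hk
  have hnorm : ∀ i, ∀ k ∈ spectrum ℝ H, ‖ĉ i k‖ = 1 := by
    intro i k hk
    have h1 : ‖c i * E k‖ = ‖E k‖ := CStarRing.norm_mem_unitary_mul _ (hcu i)
    rw [hcE, norm_smul] at h1
    have hE0 : ‖E k‖ ≠ 0 := norm_ne_zero_iff.mpr (hEne k hk)
    have := mul_left_cancel₀ hE0 (by rw [mul_comm, h1, mul_one] : ‖E k‖ * ‖ĉ i k‖ = ‖E k‖ * 1)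
    exact this
  have hstarE : ∀ i, ∀ k ∈ spectrum ℝ H, star (c i) * E k = conj (ĉ i k) • E k := by
    intro i k hk
    have hunit : star (c i) * c i = 1 := Unitary.star_mul_self_of_mem (hcu i)
    have h1 : E k = ĉ i k • (star (c i) * E k) := by
      calc E k = (star (c i) * c i) * E k := by rw [hunit, one_mul]
        _ = star (c i) * (c i * E k) := by rw [mul_assoc]
        _ = ĉ i k • (star (c i) * E k) := by rw [hcE, mul_smul_comm]
    have hne : ĉ i k ≠ 0 := fun h => by have := hnorm i k hk; rw [h, norm_zero] at this; exact zero_ne_one this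
    have hconj : conj (ĉ i k) = (ĉ i k)⁻¹ := by
      have hn : Complex.normSq (ĉ i k) = 1 := by rw [Complex.normSq_eq_norm_sq, hnorm i k hk, one_pow]
      have hmul : ĉ i k * conj (ĉ i k) = 1 := by rw [Complex.mul_conj, hn]; norm_num
      exact (eq_inv_of_mul_eq_one_right hmul)
    rw [hconj]
    calc star (c i) * E k = (ĉ i k)⁻¹ • (ĉ i k • (star (c i) * E k)) := by rw [smul_smul, inv_mul_cancel₀ hne, one_smul]
      _ = (ĉ i k)⁻¹ • E k := by rw [← h1]
  have hwords : ∀ i₁ i₂ i₃ i₄ : ι, c i₁ * c i₂ * star (c i₃) * star (c i₄) = 1 →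
      ∀ k ∈ spectrum ℝ H, ĉ i₁ k * ĉ i₂ k * conj (ĉ i₃ k) * conj (ĉ i₄ k) = 1 := by
    intro i₁ i₂ i₃ i₄ hw k hk
    have h1 : (c i₁ * c i₂ * star (c i₃) * star (c i₄)) * E k = (ĉ i₁ k * ĉ i₂ k * conj (ĉ i₃ k) * conj (ĉ i₄ k)) • E k := by
      rw [mul_assoc, mul_assoc, mul_assoc, hstarE i₄ k hk, mul_smul_comm, hstarE i₃ k hk, smul_smul, mul_smul_comm, hcE i₂ k, smul_smul,
        mul_smul_comm, hcE i₁ k, smul_smul]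
      congr 1; ring
    rw [hw, one_mul] at h1
    have h2 : (ĉ i₁ k * ĉ i₂ k * conj (ĉ i₃ k) * conj (ĉ i₄ k) - 1) • E k = 0 := by rw [sub_smul, one_smul, ← h1, sub_self]
    rcases smul_eq_zero.mp h2 with h | h
    · exact sub_eq_zero.mp h
    · exact absurd h (hEne k hk)
  have hcsum : ∀ i, c i = ∑ k ∈ (Matrix.finite_real_spectrum (A := H)).toFinset, ĉ i k • E k := by
    intro i
    calc c i = c i * ∑ k ∈ (Matrix.finite_real_spectrum (A := H)).toFinset, E k := by rw [sum_specProj H hHsa, mul_one]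
      _ = ∑ k ∈ (Matrix.finite_real_spectrum (A := H)).toFinset, c i * E k := Finset.mul_sum _ _ _
      _ = ∑ k ∈ (Matrix.finite_real_spectrum (A := H)).toFinset, ĉ i k • E k := Finset.sum_congr rfl fun k _ => hcE i k
  refine ⟨fun i => t₀ (e (Sum.inl i)), fun i => t₀ (e (Sum.inr i)), ĉ, hHsa, hcE, fun i k hk => ⟨hnorm i k hk, hstarE i k hk⟩, hwords, hcsum⟩

end

end Summit.QuantumFields.BalabanUV.T4Continuum.NE7CommutingUnitariesResolution
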